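import Literature.AnabelianGeometry.SemiGraphs.CoveringGraphStrictlyCoherent
import Literature.AnabelianGeometry.SemiGraphs.CoveringGraphThm37Hypotheses
import HarnessLib

/-!
# The hypotheses of [SemiAnbd] Prop 3.6 / Thm 3.7 / Cor 3.9 are hereditary for connected tempered
# coverings of strictly coherent semi-graphs of anabelioids (route T, bricks D + E)

Mochizuki, *Semi-graphs of anabelioids*, Publ. RIMS **42** (2006), §2 Def. 2.3 (iii) p. 25, Rmk. 2.4.1
p. 26, §3 Def. 3.5 (i) p. 37 (the covering semi-graph of anabelioids `G_S → G`, `CovObj.coveringGraph`),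
Prop. 3.6 / Thm. 3.7 pp. 38–41 [cite: MochizukiSemiAnbd2006, Rmk 2.4.1 p.26]; Galois-countability and
strict coherence from [IUTchI] Rmk. 2.5.3 (i) (T2)–(T4) p. 53 [cite: Mochizuki2012, IUTchI Rem.
2.5.3(i)(T4) p.53].

* `isQuasiCoherent_coveringGraph` — **Def. 2.3 (iii) is hereditary for `S` tempered and connected over a
  connected STRICTLY coherent `G`** (infinite `G` allowed): the restricted image approximator of
  `CoveringGraphApproximators` (`exists_approximator_coveringGraph`, abc-iut-L3-t5) fed with the (T4)
  characteristic open subgroups of uniformly bounded index (`exists_open_normal_le_ker`), which lie in all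
  the pointwise stabilisers `N'_{(c,ω)}` because the constituents `Stab_{Π_c}(s_ω)` of `G_S` have
  uniformly bounded index (`exists_index_stab_le`);
* `isGaloisCountable_coveringGraph` — **(T2) for `G_S`**, closing the residual binder of
  `CoveringGraphThm37Hypotheses` (via `CoveringGraphStrictlyCoherent`);
* `prop36Hypotheses_coveringGraph` / `thm37Hypotheses_coveringGraph` / `cor39Hypotheses_coveringGraph`
  / `isStrictlyCoherent_coveringGraph` — the ASSEMBLY: the class {hypotheses of Thm. 3.7, strictly
  coherent} is HEREDITARY along connected tempered coverings (so it climbs towers `Ÿ → Y → X`);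
* finite coherent bases: `thm37Hypotheses_coveringGraph_of_finite'` and the BODIES of Thm. 3.7
  (iii)/(iv) and of Cor. 3.9 (up to twist) at `G_S` with NO residual binder
  (`compactInVerticial_body_coveringGraph_of_finite'`, `maximalCompactIffVerticial_body_…'`,
  `cor39UpToTwistAt_coveringGraph_of_finite'`).

Proof-only (abc-iut cell, L3 route T, bricks T7d + T7e final; seat abc-iut-L3-d6); no definition, no
statement of the paper retyped; nothing here bears on [IUTchIII] Cor. 3.12.  NOT claimed: heredity of
quasi-coherence over a merely coherent infinite base.
-/

open CategoryTheory Topology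

namespace Literature.AnabelianGeometry.SemiGraphs

namespace ProfiniteSemiGraph

namespace CovObj

open Literature.AlgebraicGeometry.Frobenioids (IsConnectedObj)
open Literature.AnabelianGeometry.AbsoluteAnabelian.IsTopologicallyFinitelyGenerated
  (exists_open_normal_le_ker)

universe u

variable {𝒢 : ProfiniteSemiGraph.{u}} (S : CovObj 𝒢)

/-! ### Quasi-coherence of `G_S`: the mechanism -/

/-- **Quasi-coherence of `G_S` from uniformly bounded open subgroups below the pointwise
stabilisers.**  If for every `M` and every family of coverings of the constituents of `G_S` of degree
`≤ M` there are open subgroups `U_c ⊆ Π_c` of nonzero index `≤ β` contained in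
`N'_{(c,ω)} = {k ∈ Stab_{Π_c}(s_ω) | k` fixes `H_{(c,ω)}` pointwise`}` for all `ω`, then `G_S` is
quasi-coherent: quasi-coherence of `G` at the bound `β` (cosets of the `U_c`) gives an approximator
whose kernels lie in the `U_c`, and its restricted image approximator splits the family.
[cite: MochizukiSemiAnbd2006, Prop 3.6(v) p.40] -/
theorem isQuasiCoherent_coveringGraph_of_le_fixatorIn (hq : 𝒢.IsQuasiCoherent)
    (hU : ∀ (M : ℕ) (HV : ∀ v' : S.coveringGraph.graph.Vertex, BTemp (S.coveringGraph.Gv v'))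
      (HE : ∀ e' : S.coveringGraph.graph.Edge, BTemp (S.coveringGraph.Ge e')),
      (∀ v', Nat.card (HV v').obj.V ≤ M ∧ Finite (HV v').obj.V) →
      (∀ e', Nat.card (HE e').obj.V ≤ M ∧ Finite (HE e').obj.V) →
      ∃ (β : ℕ) (UV : ∀ v : 𝒢.graph.Vertex, Subgroup (𝒢.Gv v))
        (UE : ∀ e : 𝒢.graph.Edge, Subgroup (𝒢.Ge e)),
        (∀ v, IsOpen (UV v : Set (𝒢.Gv v)) ∧ (UV v).index ≠ 0 ∧ (UV v).index ≤ β) ∧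
        (∀ e, IsOpen (UE e : Set (𝒢.Ge e)) ∧ (UE e).index ≠ 0 ∧ (UE e).index ≤ β) ∧
        (∀ v' : S.coveringGraph.graph.Vertex,
          UV v'.1 ≤ fixatorIn (BTemp.stab (S.SV v'.1) (Quot.out v'.2)) (HV v')) ∧
        ∀ e' : S.coveringGraph.graph.Edge,
          UE e'.1 ≤ fixatorIn (BTemp.stab (S.SE e'.1) (Quot.out e'.2)) (HE e')) :
    S.coveringGraph.IsQuasiCoherent := by
  classical
  intro M HV HE hHV hHE
  obtain ⟨β, UV, UE, hUV, hUE, hleV, hleE⟩ := hU M HV HE hHV hHE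
  haveI : ∀ v, (UV v).FiniteIndex := fun v => ⟨(hUV v).2.1⟩
  haveI : ∀ e, (UE e).FiniteIndex := fun e => ⟨(hUE e).2.1⟩
  obtain ⟨A, hAV, hAE⟩ := hq β (fun v => cosetsObj (UV v) (hUV v).1 (hUV v).2.1)
    (fun e => cosetsObj (UE e) (hUE e).1 (hUE e).2.1)
    (fun v => ⟨(hUV v).2.2, inferInstanceAs (Finite (𝒢.Gv v ⧸ UV v))⟩)
    (fun e => ⟨(hUE e).2.2, inferInstanceAs (Finite (𝒢.Ge e ⧸ UE e))⟩)
  have hkerV : ∀ v (k : 𝒢.Gv v), A.πV v k = 1 → k ∈ UV v := fun v k hk =>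
    mem_of_cosetsObj_fixed (UV v) (hUV v).1 (hUV v).2.1 k (hAV v k hk)
  have hkerE : ∀ e (k : 𝒢.Ge e), A.πE e k = 1 → k ∈ UE e := fun e k hk =>
    mem_of_cosetsObj_fixed (UE e) (hUE e).1 (hUE e).2.1 k (hAE e k hk)
  obtain ⟨A', -, ⟨ιV, -, -, hιπ, -⟩, hA'E⟩ := S.exists_approximator_coveringGraph A
  refine ⟨A', fun v' k hk x => ?_, fun e' k hk x => ?_⟩
  · have hk1 : A.πV v'.1 (k : 𝒢.Gv v'.1) = 1 := by rw [← hιπ v' k, hk, map_one]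
    have hkfix : k ∈ fixator (HV v') := (mem_fixatorIn_iff _ _ k).mp (hleV v' (hkerV v'.1 k hk1))
    exact (mem_fixator_iff _ _).mp hkfix x
  · have hk1 : A.πE e'.1 (k : 𝒢.Ge e'.1) = 1 := (hA'E e' k).mp hk
    have hkfix : k ∈ fixator (HE e') := (mem_fixatorIn_iff _ _ k).mp (hleE e' (hkerE e'.1 k hk1))
    exact (mem_fixator_iff _ _).mp hkfix x

/-- The index of `N'_{(c,ω)} = {k ∈ L | k` fixes `H` pointwise`}` for `L` of nonzero index `≤ D` and `H`
of cardinality `≤ M`: nonzero and at most `D · M!`. [cite: MochizukiSemiAnbd2006, Prop 3.6(v) p.40] -/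
theorem index_fixatorIn_le {G : Type u} [Group G] [TopologicalSpace G] (L : Subgroup G)
    (hL0 : L.index ≠ 0) {D M : ℕ} (hLD : L.index ≤ D) (H : BTemp L) [Finite H.obj.V]
    (hH : Nat.card H.obj.V ≤ M) :
    (fixatorIn L H).index ≠ 0 ∧ (fixatorIn L H).index ≤ D * M.factorial := by
  rw [index_fixatorIn]
  exact ⟨Nat.mul_ne_zero (index_fixator_ne_zero _) hL0,
    by rw [Nat.mul_comm D]; exact Nat.mul_le_mul ((index_fixator_le H).trans
      (Nat.factorial_le hH)) hLD⟩

/-! ### Quasi-coherence is hereditary over strictly coherent bases ([IUTchI] (T3)/(T4)) -/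

/-- **Quasi-coherence of `G_S` for strictly coherent `G`, explicit index bound.**  If `G` is strictly
coherent and the constituents `Stab_{Π_c}(s)` of `G_S` have nonzero indices `≤ D` (all `s`), then `G_S`
is quasi-coherent: the (T4) characteristic open subgroups of index `≤ ((D·M!)!)^(((D·M!)!)^N)` lie in
every open subgroup of index `≤ D · M!`, in particular in all the `N'_{(c,ω)}`.
[cite: Mochizuki2012, IUTchI Rem. 2.5.3(i)(T4) p.53] -/
theorem isQuasiCoherent_coveringGraph_of_index_le (hsc : 𝒢.IsStrictlyCoherent) {D : ℕ}
    (hDV : ∀ (v : 𝒢.graph.Vertex) (s : (S.SV v).obj.V),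
      (BTemp.stab (S.SV v) s).index ≠ 0 ∧ (BTemp.stab (S.SV v) s).index ≤ D)
    (hDE : ∀ (e : 𝒢.graph.Edge) (s : (S.SE e).obj.V),
      (BTemp.stab (S.SE e) s).index ≠ 0 ∧ (BTemp.stab (S.SE e) s).index ≤ D) :
    S.coveringGraph.IsQuasiCoherent := by
  classical
  refine S.isQuasiCoherent_coveringGraph_of_le_fixatorIn hsc.isCoherent.1 fun M HV HE hHV hHE => ?_
  haveI : ∀ v', Finite (HV v').obj.V := fun v' => (hHV v').2
  haveI : ∀ e', Finite (HE e').obj.V := fun e' => (hHE e').2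
  obtain ⟨N, -, hgenV, hgenE⟩ := hsc.exists_bound
  let K : ℕ := D * M.factorial
  let β : ℕ := (K.factorial) ^ ((K.factorial) ^ N)
  have hUV : ∀ v : 𝒢.graph.Vertex, ∃ U : Subgroup (𝒢.Gv v), IsOpen (U : Set (𝒢.Gv v)) ∧
      U.index ≠ 0 ∧ U.index ≤ β ∧
      ∀ ρ : 𝒢.Gv v →* Equiv.Perm (Fin K), IsOpen (ρ.ker : Set (𝒢.Gv v)) → U ≤ ρ.ker := by
    intro v
    obtain ⟨s, hs, hgen⟩ := hgenV v
    obtain ⟨U, -, hUo, hUi, hUβ, hUker⟩ := exists_open_normal_le_ker s hgen K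
    exact ⟨U, hUo, hUi, hUβ.trans (bound_mono hs), hUker⟩
  have hUE : ∀ e : 𝒢.graph.Edge, ∃ U : Subgroup (𝒢.Ge e), IsOpen (U : Set (𝒢.Ge e)) ∧
      U.index ≠ 0 ∧ U.index ≤ β ∧
      ∀ ρ : 𝒢.Ge e →* Equiv.Perm (Fin K), IsOpen (ρ.ker : Set (𝒢.Ge e)) → U ≤ ρ.ker := by
    intro e
    obtain ⟨s, hs, hgen⟩ := hgenE e
    obtain ⟨U, -, hUo, hUi, hUβ, hUker⟩ := exists_open_normal_le_ker s hgen K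
    exact ⟨U, hUo, hUi, hUβ.trans (bound_mono hs), hUker⟩
  choose UV hUVo hUVi hUVβ hUVker using hUV
  choose UE hUEo hUEi hUEβ hUEker using hUE
  refine ⟨β, UV, UE, fun v => ⟨hUVo v, hUVi v, hUVβ v⟩, fun e => ⟨hUEo e, hUEi e, hUEβ e⟩,
    fun v' => ?_, fun e' => ?_⟩
  · obtain ⟨h0, hle⟩ := index_fixatorIn_le _ (hDV v'.1 _).1 (hDV v'.1 _).2 (HV v') (hHV v').1
    exact le_of_index_le (UV v'.1) (hUVker v'.1) _
      (isOpen_fixatorIn _ ((S.SV v'.1).property.2 _) _) h0 hle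
  · obtain ⟨h0, hle⟩ := index_fixatorIn_le _ (hDE e'.1 _).1 (hDE e'.1 _).2 (HE e') (hHE e').1
    exact le_of_index_le (UE e'.1) (hUEker e'.1) _
      (isOpen_fixatorIn _ ((S.SE e'.1).property.2 _) _) h0 hle

/-- **Quasi-coherence ([SemiAnbd] Def. 2.3 (iii)) is hereditary for connected tempered coverings of a
connected strictly coherent `G`** ([IUTchI] Rmk. 2.5.3 (i) (T3)/(T4); infinite `G` allowed; every
finite coherent `G` by `isStrictlyCoherent_of_finite`): the constituents of `G_S` have indices bounded
by the degree of one finite étale covering splitting `S`.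
[cite: Mochizuki2012, IUTchI Rem. 2.5.3(i)(T4) p.53] -/
theorem isQuasiCoherent_coveringGraph (hconn : 𝒢.IsConnected) (hsc : 𝒢.IsStrictlyCoherent)
    (hS : S.IsTempered) (hSc : IsConnectedObj (⟨S, hS⟩ : BTempCat 𝒢)) :
    S.coveringGraph.IsQuasiCoherent := by
  obtain ⟨D, hDV, hDE⟩ := S.exists_index_stab_le hconn hS hSc
  exact S.isQuasiCoherent_coveringGraph_of_index_le hsc hDV hDE

/-! ### (T2) Galois-countability and (T3) strict coherence of `G_S` -/

/-- **`G_S` is Galois-countable** ([IUTchI] Rmk. 2.5.3 (i) (T2)) for `G` connected, countable, strictly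
coherent with a vertex and `S` tempered and connected. [cite: Mochizuki2012, IUTchI Rem. 2.5.3(i)(T4) p.53] -/
theorem isGaloisCountable_coveringGraph_of (hconn : 𝒢.IsConnected) (hv : 𝒢.HasVertex)
    (hcnt : 𝒢.IsCountable) (hsc : 𝒢.IsStrictlyCoherent) (hS : S.IsTempered)
    (hSc : IsConnectedObj (⟨S, hS⟩ : BTempCat 𝒢)) : S.coveringGraph.IsGaloisCountable :=
  S.isGaloisCountable_coveringGraph_of_isQuasiCoherent hconn hv hcnt hsc hS hSc
    (S.isQuasiCoherent_coveringGraph hconn hsc hS hSc)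

/-- **`G_S` is Galois-countable** for `G` as in Prop. 3.6 and strictly coherent, `S` tempered and
connected. [cite: Mochizuki2012, IUTchI Rem. 2.5.3(i)(T4) p.53] -/
theorem isGaloisCountable_coveringGraph (h36 : 𝒢.Prop36Hypotheses) (hsc : 𝒢.IsStrictlyCoherent)
    (hS : S.IsTempered) (hSc : IsConnectedObj (⟨S, hS⟩ : BTempCat 𝒢)) :
    S.coveringGraph.IsGaloisCountable :=
  S.isGaloisCountable_coveringGraph_of h36.isConnected h36.hasVertex h36.isCountable hsc hS hSc

/-- **`G_S` is Galois-countable** over a FINITE coherent base as in Prop. 3.6 — the residual binder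
`hGC` of `thm37Hypotheses_coveringGraph_of_finite` (`CoveringGraphThm37Hypotheses`) discharged.
[cite: Mochizuki2012, IUTchI Rem. 2.5.3(i)(T4) p.53] -/
theorem isGaloisCountable_coveringGraph_of_finite [Finite 𝒢.graph.Vertex] [Finite 𝒢.graph.Edge]
    (h36 : 𝒢.Prop36Hypotheses) (hcoh : 𝒢.IsCoherent) (hS : S.IsTempered)
    (hSc : IsConnectedObj (⟨S, hS⟩ : BTempCat 𝒢)) : S.coveringGraph.IsGaloisCountable :=
  S.isGaloisCountable_coveringGraph h36 (isStrictlyCoherent_of_finite ⟨‹_›, ‹_›⟩ hcoh) hS hSc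

/-- **`G_S` is strictly coherent** ([IUTchI] Rmk. 2.5.3 (i) (T3)) for `G` connected and strictly coherent,
`S` tempered and connected. [cite: Mochizuki2012, IUTchI Rem. 2.5.3(i)(T3) p.53] -/
theorem isStrictlyCoherent_coveringGraph (hconn : 𝒢.IsConnected) (hsc : 𝒢.IsStrictlyCoherent)
    (hS : S.IsTempered) (hSc : IsConnectedObj (⟨S, hS⟩ : BTempCat 𝒢)) :
    S.coveringGraph.IsStrictlyCoherent :=
  S.isStrictlyCoherent_coveringGraph_of_isQuasiCoherent' hconn hsc hS hSc
    (S.isQuasiCoherent_coveringGraph hconn hsc hS hSc)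

/-- In particular `G_S` is coherent. [cite: MochizukiSemiAnbd2006, Def 2.3(iii) p.25] -/
theorem isCoherent_coveringGraph (hconn : 𝒢.IsConnected) (hsc : 𝒢.IsStrictlyCoherent)
    (hS : S.IsTempered) (hSc : IsConnectedObj (⟨S, hS⟩ : BTempCat 𝒢)) :
    S.coveringGraph.IsCoherent :=
  (S.isStrictlyCoherent_coveringGraph hconn hsc hS hSc).isCoherent

/-! ### Assembly: the hypotheses of Prop 3.6 / Thm 3.7 / Cor 3.9 are hereditary -/

/-- **The hypotheses of [SemiAnbd] Prop. 3.6 are hereditary**: for `G` satisfying them and strictly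
coherent (e.g. finite coherent) and `S` a connected tempered covering, the covering semi-graph of
anabelioids `G_S` satisfies them (connected/countable/injective type/slim: brick T7a; aloof: T7b
(abc-iut-L3-t5); elevated: T7c (abc-iut-L3-t5); quasi-coherent, Galois-countable, vertex: this
lineage). [cite: MochizukiSemiAnbd2006, Prop 3.6 p.38] -/
theorem prop36Hypotheses_coveringGraph (h36 : 𝒢.Prop36Hypotheses) (hsc : 𝒢.IsStrictlyCoherent)
    (hS : S.IsTempered) (hSc : IsConnectedObj (⟨S, hS⟩ : BTempCat 𝒢)) :
    S.coveringGraph.Prop36Hypotheses where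
  isConnected := S.isConnected_coveringGraph hS hSc
  isCountable := S.isCountable_coveringGraph h36.isCountable
  isGaloisCountable := S.isGaloisCountable_coveringGraph h36 hsc hS hSc
  hasVertex := S.hasVertex_coveringGraph_of_isConnectedObj h36.isConnected h36.hasVertex hS hSc
  isOfInjectiveType := S.isOfInjectiveType_coveringGraph h36.isOfInjectiveType
  isQuasiCoherent := S.isQuasiCoherent_coveringGraph h36.isConnected hsc hS hSc
  isTotallyElevated := S.isTotallyElevated_coveringGraph h36.isTotallyElevated hS
  isTotallyAloof := S.isTotallyAloof_coveringGraph h36.isTotallyAloof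
  isVerticiallySlim := S.isVerticiallySlim_coveringGraph h36.isVerticiallySlim

/-- **The hypotheses of [SemiAnbd] Thm. 3.7 are hereditary** (same setting, `G` totally estranged).
[cite: MochizukiSemiAnbd2006, Thm 3.7 p.40] -/
theorem thm37Hypotheses_coveringGraph (h37 : 𝒢.Thm37Hypotheses) (hsc : 𝒢.IsStrictlyCoherent)
    (hS : S.IsTempered) (hSc : IsConnectedObj (⟨S, hS⟩ : BTempCat 𝒢)) :
    S.coveringGraph.Thm37Hypotheses where
  toProp36Hypotheses := S.prop36Hypotheses_coveringGraph h37.toProp36Hypotheses hsc hS hSc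
  isTotallyEstranged := S.isTotallyEstranged_coveringGraph h37.isTotallyEstranged

/-- **The hypotheses of [SemiAnbd] Cor. 3.9 are hereditary** (same setting, `G` a graph).
[cite: MochizukiSemiAnbd2006, Cor 3.9 p.42] -/
theorem cor39Hypotheses_coveringGraph (h39 : Cor39Hypotheses 𝒢) (hsc : 𝒢.IsStrictlyCoherent)
    (hS : S.IsTempered) (hSc : IsConnectedObj (⟨S, hS⟩ : BTempCat 𝒢)) :
    Cor39Hypotheses S.coveringGraph where
  toProp36Hypotheses := S.prop36Hypotheses_coveringGraph h39.toProp36Hypotheses hsc hS hSc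
  isTotallyEstranged := S.isTotallyEstranged_coveringGraph h39.isTotallyEstranged
  isGraph := S.isGraph_coveringGraph h39.isGraph

/-- **Heredity along towers**: the class "hypotheses of Thm. 3.7 + strictly coherent" passes from `G`
to `G_S` for every connected tempered `S`, so it can be iterated along towers of connected tempered
coverings (`Ÿ → Y → X`). [cite: Mochizuki2012, IUTchI Rem. 2.5.3(i)(T3) p.53] -/
theorem thm37Hypotheses_and_isStrictlyCoherent_coveringGraph (h37 : 𝒢.Thm37Hypotheses)
    (hsc : 𝒢.IsStrictlyCoherent) (hS : S.IsTempered) (hSc : IsConnectedObj (⟨S, hS⟩ : BTempCat 𝒢)) :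
    S.coveringGraph.Thm37Hypotheses ∧ S.coveringGraph.IsStrictlyCoherent :=
  ⟨S.thm37Hypotheses_coveringGraph h37 hsc hS hSc,
    S.isStrictlyCoherent_coveringGraph h37.isConnected hsc hS hSc⟩

/-! ### Finite coherent bases: no residual binder -/

/-- **Thm. 3.7's hypotheses for `G_S` over a FINITE coherent Thm-3.7 graph**, for every connected
tempered covering `S` — `thm37Hypotheses_coveringGraph_of_finite` (abc-iut-L3-t5) with its
Galois-countability binder `hGC` and its vertex point `x` discharged.
[cite: MochizukiSemiAnbd2006, Thm 3.7 p.40] -/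
theorem thm37Hypotheses_coveringGraph_of_finite' [Finite 𝒢.graph.Vertex] [Finite 𝒢.graph.Edge]
    (h37 : 𝒢.Thm37Hypotheses) (hcoh : 𝒢.IsCoherent) (hS : S.IsTempered)
    (hSc : IsConnectedObj (⟨S, hS⟩ : BTempCat 𝒢)) : S.coveringGraph.Thm37Hypotheses :=
  S.thm37Hypotheses_coveringGraph h37 (isStrictlyCoherent_of_finite ⟨‹_›, ‹_›⟩ hcoh) hS hSc

/-- **Cor. 3.9's hypotheses for `G_S` over a FINITE coherent Cor-3.9 graph**, for every connected
tempered covering `S`. [cite: MochizukiSemiAnbd2006, Cor 3.9 p.42] -/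
theorem cor39Hypotheses_coveringGraph_of_finite [Finite 𝒢.graph.Vertex] [Finite 𝒢.graph.Edge]
    (h39 : Cor39Hypotheses 𝒢) (hcoh : 𝒢.IsCoherent) (hS : S.IsTempered)
    (hSc : IsConnectedObj (⟨S, hS⟩ : BTempCat 𝒢)) : Cor39Hypotheses S.coveringGraph :=
  S.cor39Hypotheses_coveringGraph h39 (isStrictlyCoherent_of_finite ⟨‹_›, ‹_›⟩ hcoh) hS hSc

/-- **The BODY of [SemiAnbd] Thm 3.7 (iii) at `G_S`, UNCONDITIONALLY**, for every connected tempered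
covering `S` of a finite coherent Thm-3.7 graph of anabelioids and every tempered fundamental group of
`G_S`: every compact subgroup lies in a verticial subgroup; a non-trivial one in at most two, and then in
an edge-like subgroup of a closed edge. [cite: MochizukiSemiAnbd2006, Thm 3.7(iii) pp.40-41] -/
theorem compactInVerticial_body_coveringGraph_of_finite' [Finite 𝒢.graph.Vertex] [Finite 𝒢.graph.Edge]
    (h37 : 𝒢.Thm37Hypotheses) (hcoh : 𝒢.IsCoherent) (hS : S.IsTempered)
    (hSc : IsConnectedObj (⟨S, hS⟩ : BTempCat 𝒢)) (c : TemperedPiChart S.coveringGraph)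
    (C : Subgroup c.G) (hC : IsCompact (C : Set c.G)) :
    (∃ (w : S.coveringGraph.graph.Vertex) (H : Subgroup c.G), H ∈ verticialSubgroups c w ∧ C ≤ H) ∧
      (C ≠ ⊥ → ∀ (v₁ v₂ : S.coveringGraph.graph.Vertex) (H₁ H₂ : Subgroup c.G),
        H₁ ∈ verticialSubgroups c v₁ → H₂ ∈ verticialSubgroups c v₂ → H₁ ≠ H₂ → C ≤ H₁ → C ≤ H₂ →
          (∀ (v₃ : S.coveringGraph.graph.Vertex) (H₃ : Subgroup c.G),
              H₃ ∈ verticialSubgroups c v₃ → C ≤ H₃ → H₃ = H₁ ∨ H₃ = H₂) ∧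
          ∃ (e : S.coveringGraph.graph.Edge) (L : Subgroup c.G), S.coveringGraph.graph.IsClosedEdge e ∧
            L ∈ edgeLikeSubgroups c e ∧ C ≤ L) :=
  S.compactInVerticialAt_coveringGraph_of_finite' h37 hcoh hS
    (S.thm37Hypotheses_coveringGraph_of_finite' h37 hcoh hS hSc) c C hC

/-- **The BODY of [SemiAnbd] Thm 3.7 (iv) at `G_S`, UNCONDITIONALLY** (same setting): the maximal
compact subgroups of `π₁^temp(G_S)` are exactly the verticial subgroups, and the non-trivial
intersections of two distinct maximal compact subgroups are exactly the edge-like subgroups of closed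
edges. [cite: MochizukiSemiAnbd2006, Thm 3.7(iv) p.41] -/
theorem maximalCompactIffVerticial_body_coveringGraph_of_finite' [Finite 𝒢.graph.Vertex]
    [Finite 𝒢.graph.Edge] (h37 : 𝒢.Thm37Hypotheses) (hcoh : 𝒢.IsCoherent) (hS : S.IsTempered)
    (hSc : IsConnectedObj (⟨S, hS⟩ : BTempCat 𝒢)) (c : TemperedPiChart S.coveringGraph) :
    (∀ K : Subgroup c.G, IsMaximalCompactSubgroup K ↔ ∃ w, K ∈ verticialSubgroups c w) ∧
    ∀ L : Subgroup c.G, L ≠ ⊥ →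
      ((∃ K₁ K₂ : Subgroup c.G, IsMaximalCompactSubgroup K₁ ∧ IsMaximalCompactSubgroup K₂ ∧
          K₁ ≠ K₂ ∧ L = K₁ ⊓ K₂) ↔
        ∃ e, S.coveringGraph.graph.IsClosedEdge e ∧ L ∈ edgeLikeSubgroups c e) :=
  S.maximalCompactIffVerticialAt_coveringGraph_of_finite' h37 hcoh hS
    (S.thm37Hypotheses_coveringGraph_of_finite' h37 hcoh hS hSc) c

/-- **[SemiAnbd] Cor. 3.9 (compatible reading, up to twist) between the covering semi-graphs of
anabelioids `G_S`, `H_T` of connected tempered coverings of FINITE coherent Cor-3.9 graphs `G`, `H`,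
UNCONDITIONALLY** (`cor39UpToTwistAt_coveringGraph_of_finite` of `Thm37AtCoveringGraph` with its
`Cor39Hypotheses` binders for `G_S`, `H_T` discharged). [cite: MochizukiSemiAnbd2006, Cor 3.9 pp.42-43] -/
theorem cor39UpToTwistAt_coveringGraph_of_finite' {ℋ : ProfiniteSemiGraph.{u}}
    [Finite 𝒢.graph.Vertex] [Finite 𝒢.graph.Edge] [Finite ℋ.graph.Vertex] [Finite ℋ.graph.Edge]
    (h𝒢 : Cor39Hypotheses 𝒢) (hcoh : 𝒢.IsCoherent) (hℋ : Cor39Hypotheses ℋ) (hcohℋ : ℋ.IsCoherent)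
    (hS : S.IsTempered) (hSc : IsConnectedObj (⟨S, hS⟩ : BTempCat 𝒢)) (T : CovObj ℋ)
    (hT : T.IsTempered) (hTc : IsConnectedObj (⟨T, hT⟩ : BTempCat ℋ))
    (cS : TemperedPiChart S.coveringGraph) (cT : TemperedPiChart T.coveringGraph) :
    (∀ (F : ProfiniteSemiGraph.Hom S.coveringGraph T.coveringGraph), F.IsLocallyOpen →
        ∀ φ : cS.G →ₜ* cT.G,
          (∃ θ : F.ConjugatorFamily, Nonempty (F.chartPullbackWith θ cS cT ≅ BTemp.res φ)) →
            IsCompatiblyQuasiGeometric φ) ∧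
      ∀ φ : cS.G →ₜ* cT.G, IsCompatiblyQuasiGeometric φ →
        ∃ F : ProfiniteSemiGraph.Hom S.coveringGraph T.coveringGraph, F.IsLocallyOpen ∧
          (∃ θ : F.ConjugatorFamily, Nonempty (F.chartPullbackWith θ cS cT ≅ BTemp.res φ)) ∧
          ∀ F' : ProfiniteSemiGraph.Hom S.coveringGraph T.coveringGraph, F'.IsLocallyOpen →
            (∃ θ' : F'.ConjugatorFamily, Nonempty (F'.chartPullbackWith θ' cS cT ≅ BTemp.res φ)) →
              F'.base.vertexMap = F.base.vertexMap ∧ F'.base.edgeMap = F.base.edgeMap :=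
  S.cor39UpToTwistAt_coveringGraph_of_finite
    ⟨h𝒢.toProp36Hypotheses, h𝒢.isTotallyEstranged⟩ hcoh ⟨hℋ.toProp36Hypotheses, hℋ.isTotallyEstranged⟩
    hcohℋ hS T hT (S.cor39Hypotheses_coveringGraph_of_finite h𝒢 hcoh hS hSc)
    (T.cor39Hypotheses_coveringGraph_of_finite hℋ hcohℋ hT hTc) cS cT

end CovObj

end ProfiniteSemiGraph

end Literature.AnabelianGeometry.SemiGraphs
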